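import Mathlib.Analysis.SpecialFunctions.Pow.Real

/-!
# Giorgi–Klainerman–Szeftel §15.1.3, I: the chain of inequalities proving (13.6.6), as real arithmetic

CITATION HEADER (lean-in-tree rule 2026-08-18).  Companion of `EstimateShapes`, `CurvatureEstimateShapes` and
`CurvatureAssembly` (same sources and conventions: `GKS l.N` = TeX line of arXiv:2205.14808v1 = bib key
`GiorgiKlainermanSzeftel2022`; `journal …, HAL p.N` = Pure Appl. Math. Q. **20** (2024) 2865–3849 = bib key
`GiorgiKlainermanSzeftel2024`, read in the authors' version hal-05348127v1, printed page = PDF page − 1).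

WHAT IS REPRODUCED, and in what sense.  GKS prove estimate (13.6.6) of Theorem 13.6.3 (journal: (13.6.7)) in §15.1.3
(`sec:proofofeq:InteriorcurvEstimatesThmM8`, GKS l.27220–27271; journal §15.1.3 "Proof of (13.6.7) in Theorem 13.6.3",
HAL p.658–659, word for word the same) by a half-page chain of displayed inequalities from four inputs: Theorem 14.1.3
(the bound for `δ_{J+1}[P̌] = BEF^J_δ[r²P̌]`, l.27228–27231), Proposition 15.1.1 (l.27232–27236), Proposition 15.1.2
(l.27243–27249) and the norm comparison `(int)ℜ²_{J+1} ≲ r₀³ BEF^J_δ[A, B, P̌, B̲, A̲]` (l.27256–27264).  THIS module is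
that chain as ONE inequality `rint_sq_core` between nonnegative reals, with every hidden `≲`-constant an explicit
parameter (`K₁, K₂, K₃ ≥ 1`, `K₄ ≥ 0`) and the output constant an explicit polynomial in them, Mathlib-only; the module
`CurvatureAssembly` instantiates it on the statement shapes of `CurvatureEstimateShapes`.  The two elementary moves the
text leaves implicit are made explicit: square-root splitting for `√δ_{J+1}[P̌]`, `√δ_{J+1}[B]`, `√δ_{J+1}[B̲]` (from
`δ ≤ Y²` for a sum `Y` of nonnegative terms: `√δ ≤ Y`), and the weighted AM–GM inequality
`3 t² 𝔖 Q ≤ t⁴ Q² + 2 t 𝔖^{3/2} Q^{1/2}` (`t = r₀^{15/4}`, `Q = ε₀ + √ε_J √(𝔖_{J+1}+ℜ_{J+1})`; `amgm_tuq`), which is the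
step from l.27239–27240 (`r₀^{15/2} 𝔖_{J+1} Q`) to l.27253–27254 (`r₀^{15/4} 𝔖_{J+1}^{3/2} Q^{1/2}`).  The passage from
`|a|² 𝔖²_{J+1}` (l.27239, from the displayed Props 15.1.1/15.1.2) to `|a| 𝔖²_{J+1}` (l.27253) is the hypothesis `a ≤ A`
(`A ≥ 1`; in `CurvatureAssembly`, `A = max 1 m` by subextremality) — the only place a bound on `|a|` enters, and it is
not a smallness condition.  Zero sorry, axioms ⊆ {propext, Classical.choice, Quot.sound}; elementary real arithmetic
proved here, not a claim about the papers' analysis (which is entirely inside the hypotheses `h1`–`h4`).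

Nothing here is Final-State-Conjecture progress: value = typed skeleton / precise gap, per the contract of the audit cell
`pub-kerr` (cell LEMMAS.md §4 node "GKS13.6.3 ⇐ 14.1.3 + 15.1.1 + 15.1.2 + 16.1.1").  STAGING: new module; a copy is
staged as `KerrSkeleton/Nodes/GKS1363.lean`.
-/

noncomputable section

namespace Literature.Geometry.Lorentzian.GiorgiKlainermanSzeftel2022.CurvatureAssemblyArith

/-! ## §1 Two elementary moves -/

/-- AM–GM for three terms in polynomial form: if `X³ = B·C²` with `B, C ≥ 0` then `3X ≤ B + 2C`
(from `(B+2C)³ − 27BC² = (B−C)²(B+8C) ≥ 0` and monotonicity of the cube). [folklore] -/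
theorem amgm_cube {X B C : ℝ} (hB : 0 ≤ B) (hC : 0 ≤ C) (h : X ^ 3 = B * C ^ 2) :
    3 * X ≤ B + 2 * C := by
  have key : (B + 2 * C) ^ 3 - 27 * (B * C ^ 2) = (B - C) ^ 2 * (B + 8 * C) := by ring
  have h1 : (3 * X) ^ 3 ≤ (B + 2 * C) ^ 3 := by
    have h2 : (3 * X) ^ 3 = 27 * (B * C ^ 2) := by rw [← h]; ring
    have h3 : 0 ≤ (B - C) ^ 2 * (B + 8 * C) :=
      mul_nonneg (sq_nonneg (B - C)) (by linarith)
    linarith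
  exact (Odd.strictMono_pow (⟨1, by norm_num⟩ : Odd 3)).le_iff_le.mp h1

/-- The weighted AM–GM step of GKS l.27239 → l.27253 with `u = √𝔖`, `q = √Q`:
`3 t² u² q² ≤ t⁴ (q²)² + 2 t u³ q`, i.e. `3 t² 𝔖 Q ≤ t⁴ Q² + 2 t 𝔖^{3/2} Q^{1/2}`. [folklore] -/
theorem amgm_tuq {t u q : ℝ} (ht : 0 ≤ t) (hu : 0 ≤ u) (hq : 0 ≤ q) :
    3 * (t ^ 2 * u ^ 2 * q ^ 2) ≤ t ^ 4 * (q ^ 2) ^ 2 + 2 * (t * (u ^ 2 * u) * q) :=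
  amgm_cube (by positivity) (by positivity) (by ring)

/-! ## §2 The chain -/

/-- **The chain of GKS §15.1.3 (proof of (13.6.6)), as one inequality between reals.**  Dictionary: `S = 𝔖_{J+1}`,
`R = ℜ_{J+1}`, `SJ = 𝔖_J`, `RJ = ℜ_J`, `e0 = ε₀`, `eJ = ε_J`, `a = |a|`, `A ≥ max(1,a)` (in `CurvatureAssembly`: `max 1 m`), `t = r₀^{15/4}`
(so `t⁴ = r₀^{15}`), `dP = δ_{J+1}[P̌]`, `dB = δ_{J+1}[B]`, `dBb = δ_{J+1}[B̲]`, `aA = BEF^J_δ[r²A]`, `aAb = BEF^J_δ[A̲]`,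
`r0c = r₀³`, `Rint2 = (int)ℜ²_{J+1}`.  Hypotheses: `hit` = iteration assumption (13.6.4) `𝔖_J + ℜ_J ≤ ε_J`; `h1` = Thm 14.1.3
(l.27230); `h2` = Prop 15.1.1 (l.27234–27235); `h3`, `h3b` = Prop 15.1.2 (l.27246–27247); `h4` = l.27263 composed with
l.27258.  Conclusion = l.27267–27268 divided through: `(int)ℜ² ≤ C·r₀³·(t⁴(ε_J(𝔖+ℜ)+ε_J²+ε₀²) + |a|𝔖² + t 𝔖^{3/2} Q^{1/2})`
with `C = 2·A·K₄·(K₁ + K₂(2K₁+3) + K₃(3K₂(2K₁+3)+6))`.  Intermediate displays reproduced inside the proof: l.27239–27240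
(`hD` with `G₁`) and l.27253–27254 (`hGf`).  Elementary; proved here (the analysis is in the hypotheses).
[cite: GiorgiKlainermanSzeftel2022, §15.1.3 proof of (13.6.6), TeX l.27227–27271; journal GiorgiKlainermanSzeftel2024 §15.1.3, HAL p.658–659] -/
theorem rint_sq_core
    {S R SJ RJ e0 eJ a t dP dB dBb aA aAb r0c Rint2 K1 K2 K3 K4 A : ℝ}
    (hS : 0 ≤ S) (hR : 0 ≤ R) (hSJ : 0 ≤ SJ) (hRJ : 0 ≤ RJ) (he0 : 0 ≤ e0) (heJ : 0 ≤ eJ)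
    (ha : 0 ≤ a) (haA : a ≤ A) (hA : 1 ≤ A) (ht : 1 ≤ t)
    (hdB0 : 0 ≤ dB) (hdBb0 : 0 ≤ dBb) (hr0c : 0 ≤ r0c)
    (hK1 : 1 ≤ K1) (hK2 : 1 ≤ K2) (hK3 : 1 ≤ K3) (hK4 : 0 ≤ K4)
    (hit : SJ + RJ ≤ eJ)
    (h1 : dP ≤ K1 * t ^ 4 * (S * SJ + R * RJ + eJ ^ 2 + e0 ^ 2))
    (h2 : dB + dBb ≤ K2 * (dP + e0 ^ 2 + eJ ^ 2 + a ^ 2 * S ^ 2 + eJ * R + (Real.sqrt dP + e0 + eJ) * S))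
    (h3 : aA ≤ K3 * (dB + e0 ^ 2 + eJ ^ 2 + (Real.sqrt dB + e0 + eJ) * S + a ^ 2 * S ^ 2))
    (h3b : aAb ≤ K3 * (dBb + e0 ^ 2 + eJ ^ 2 + (Real.sqrt dBb + e0 + eJ) * S + a ^ 2 * S ^ 2))
    (h4 : Rint2 ≤ K4 * r0c * (dP + dB + dBb + aA + aAb)) :
    Rint2 ≤ 2 * A * K4 * (K1 + K2 * (2 * K1 + 3) + K3 * (3 * (K2 * (2 * K1 + 3)) + 6)) * r0c *
      (t ^ 4 * (eJ * (S + R) + eJ ^ 2 + e0 ^ 2) + a * S ^ 2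
        + t * (S * Real.sqrt S) * Real.sqrt (e0 + Real.sqrt eJ * Real.sqrt (S + R))) := by
  have ht0 : 0 ≤ t := by linarith only [ht]
  have ht20 : 0 ≤ t ^ 2 := by positivity
  have ht40 : 0 ≤ t ^ 4 := by positivity
  have ht2 : 1 ≤ t ^ 2 := one_le_pow₀ ht
  have ht41 : 1 ≤ t ^ 4 := one_le_pow₀ ht
  have ht4 : t ^ 2 ≤ t ^ 4 := pow_le_pow_right₀ ht (by norm_num)
  have hK10 : 0 ≤ K1 := by linarith only [hK1]
  have hK20 : 0 ≤ K2 := by linarith only [hK2]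
  have hK30 : 0 ≤ K3 := by linarith only [hK3]
  -- abbreviations for the square roots
  set Z := S + R with hZdef
  have hZ : 0 ≤ Z := by rw [hZdef]; linarith only [hS, hR]
  set v := Real.sqrt eJ with hvdef
  set z := Real.sqrt Z with hzdef
  set u := Real.sqrt S with hudef
  have hv0 : 0 ≤ v := Real.sqrt_nonneg _
  have hz0 : 0 ≤ z := Real.sqrt_nonneg _
  have hu0 : 0 ≤ u := Real.sqrt_nonneg _
  have hv2 : v ^ 2 = eJ := Real.sq_sqrt heJ
  have hz2 : z ^ 2 = Z := Real.sq_sqrt hZ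
  have hu2 : u ^ 2 = S := Real.sq_sqrt hS
  have hvz : 0 ≤ v * z := mul_nonneg hv0 hz0
  set Q := e0 + v * z with hQdef
  have hQ0 : 0 ≤ Q := by rw [hQdef]; linarith only [he0, hvz]
  have he0Q : e0 ≤ Q := by rw [hQdef]; linarith only [hvz]
  set q := Real.sqrt Q with hqdef
  have hq0 : 0 ≤ q := Real.sqrt_nonneg _
  have hq2 : q ^ 2 = Q := Real.sq_sqrt hQ0
  set E := eJ * Z + eJ ^ 2 + e0 ^ 2 with hEdef
  have heJZ : 0 ≤ eJ * Z := mul_nonneg heJ hZ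
  have he02 : 0 ≤ e0 ^ 2 := sq_nonneg _
  have heJ2 : 0 ≤ eJ ^ 2 := sq_nonneg _
  have hE0 : 0 ≤ E := by rw [hEdef]; linarith only [heJZ, he02, heJ2]
  have he0E : e0 ^ 2 + eJ ^ 2 ≤ E := by rw [hEdef]; linarith only [heJZ]
  have heJS' : 0 ≤ eJ * S := mul_nonneg heJ hS
  have heJR' : 0 ≤ eJ * R := mul_nonneg heJ hR
  have hEsplit : E = eJ * S + eJ * R + eJ ^ 2 + e0 ^ 2 := by rw [hEdef, hZdef]; ring
  have heJR : eJ * R ≤ E := by linarith only [hEsplit, heJS', heJ2, he02]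
  have heJS : eJ * S ≤ E := by linarith only [hEsplit, heJR', heJ2, he02]
  have hEsq : E ≤ (Q + eJ) ^ 2 := by
    have hx : (Q + eJ) ^ 2 = E + (2 * (e0 * (v * z)) + 2 * (e0 * eJ) + 2 * ((v * z) * eJ)) := by
      rw [hEdef, hQdef, ← hv2, ← hz2]; ring
    have n1 := mul_nonneg he0 hvz
    have n2 := mul_nonneg he0 heJ
    have n3 := mul_nonneg hvz heJ
    linarith only [hx, n1, n2, n3]
  have hQ2E : Q ^ 2 ≤ 2 * E := by
    have hx : Q ^ 2 = e0 ^ 2 + 2 * (e0 * (v * z)) + eJ * Z := by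
      rw [hQdef, ← hv2, ← hz2]; ring
    have hsq : 0 ≤ (e0 - v * z) ^ 2 := sq_nonneg _
    have hx2 : (e0 - v * z) ^ 2 = e0 ^ 2 - 2 * (e0 * (v * z)) + eJ * Z := by
      rw [← hv2, ← hz2]; ring
    rw [hEdef]; linarith only [hx, hsq, hx2, heJ2]
  have hEt : E ≤ t ^ 4 * E := by
    have h₀ := mul_nonneg (sub_nonneg.mpr ht41) hE0
    linarith only [h₀]
  -- Step 1 (Thm 14.1.3 + iteration assumption): dP ≤ K1 t⁴ E
  have hSJe : SJ ≤ eJ := by linarith only [hit, hRJ]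
  have hRJe : RJ ≤ eJ := by linarith only [hit, hSJ]
  have hin : S * SJ + R * RJ + eJ ^ 2 + e0 ^ 2 ≤ E := by
    have h₁ := mul_le_mul_of_nonneg_left hSJe hS
    have h₂ := mul_le_mul_of_nonneg_left hRJe hR
    linarith only [h₁, h₂, hEsplit]
  have hK1t : 0 ≤ K1 * t ^ 4 := mul_nonneg hK10 ht40
  have hdP : dP ≤ K1 * t ^ 4 * E := le_trans h1 (mul_le_mul_of_nonneg_left hin hK1t)
  -- Step 2: √dP ≤ K1 t² (Q + eJ)
  have hQe0 : 0 ≤ Q + eJ := by linarith only [hQ0, heJ]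
  have hKy : 0 ≤ K1 * t ^ 2 * (Q + eJ) := by positivity
  have hsdP : Real.sqrt dP ≤ K1 * t ^ 2 * (Q + eJ) := by
    refine (Real.sqrt_le_sqrt ?_).trans (Real.sqrt_sq hKy).le
    have h₁ : K1 * t ^ 4 * E ≤ K1 * t ^ 4 * (Q + eJ) ^ 2 := mul_le_mul_of_nonneg_left hEsq hK1t
    have hK1sq : K1 ≤ K1 ^ 2 := by nlinarith only [hK1]
    have h₂ : K1 * (t ^ 4 * (Q + eJ) ^ 2) ≤ K1 ^ 2 * (t ^ 4 * (Q + eJ) ^ 2) :=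
      mul_le_mul_of_nonneg_right hK1sq (by positivity)
    calc dP ≤ K1 * t ^ 4 * E := hdP
      _ ≤ K1 * t ^ 4 * (Q + eJ) ^ 2 := h₁
      _ = K1 * (t ^ 4 * (Q + eJ) ^ 2) := by ring
      _ ≤ K1 ^ 2 * (t ^ 4 * (Q + eJ) ^ 2) := h₂
      _ = (K1 * t ^ 2 * (Q + eJ)) ^ 2 := by ring
  -- Step 3 (Prop 15.1.1): dB + dBb ≤ c2 · G₂ with G₂ := t⁴E + a²S² + t²SQ
  set G2 := t ^ 4 * E + a ^ 2 * S ^ 2 + t ^ 2 * S * Q with hG2def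
  have haS2 : 0 ≤ a ^ 2 * S ^ 2 := by positivity
  have haS1 : 0 ≤ a * S ^ 2 := by positivity
  have htSQ : 0 ≤ t ^ 2 * S * Q := by positivity
  have ht4E : 0 ≤ t ^ 4 * E := mul_nonneg ht40 hE0
  have hG20 : 0 ≤ G2 := by rw [hG2def]; linarith only [ht4E, haS2, htSQ]
  have he0S : e0 * S ≤ t ^ 2 * S * Q := by
    have h₁ : e0 * S ≤ Q * S := mul_le_mul_of_nonneg_right he0Q hS
    have h₂ : 0 ≤ (t ^ 2 - 1) * (S * Q) := mul_nonneg (sub_nonneg.mpr ht2) (mul_nonneg hS hQ0)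
    linarith only [h₁, h₂]
  have ht2eJS : t ^ 2 * (eJ * S) ≤ t ^ 4 * E := by
    have h₁ : t ^ 2 * (eJ * S) ≤ t ^ 4 * (eJ * S) := mul_le_mul_of_nonneg_right ht4 heJS'
    have h₂ : t ^ 4 * (eJ * S) ≤ t ^ 4 * E := mul_le_mul_of_nonneg_left heJS ht40
    linarith only [h₁, h₂]
  have hcross1 : (Real.sqrt dP + e0 + eJ) * S
      ≤ (K1 + 1) * (t ^ 2 * S * Q) + (K1 + 1) * (t ^ 4 * E) := by
    have h₁ : (Real.sqrt dP + e0 + eJ) * S ≤ (K1 * t ^ 2 * (Q + eJ) + e0 + eJ) * S :=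
      mul_le_mul_of_nonneg_right (by linarith only [hsdP]) hS
    have hx : (K1 * t ^ 2 * (Q + eJ) + e0 + eJ) * S
        = K1 * (t ^ 2 * S * Q) + K1 * (t ^ 2 * (eJ * S)) + e0 * S + eJ * S := by ring
    have h₄ : K1 * (t ^ 2 * (eJ * S)) ≤ K1 * (t ^ 4 * E) := mul_le_mul_of_nonneg_left ht2eJS hK10
    have h₅ : eJ * S ≤ t ^ 4 * E := le_trans heJS hEt
    linarith only [h₁, hx, h₄, h₅, he0S]
  set c2 := K2 * (2 * K1 + 3) with hc2def
  have hc21 : 1 ≤ c2 := by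
    have h₀ : 1 * 5 ≤ K2 * (2 * K1 + 3) := mul_le_mul hK2 (by linarith only [hK1]) (by norm_num) hK20
    rw [hc2def]; linarith only [h₀]
  have hc20 : 0 ≤ c2 := by linarith only [hc21]
  have hdBsum : dB + dBb ≤ c2 * G2 := by
    have hb : dP + e0 ^ 2 + eJ ^ 2 + a ^ 2 * S ^ 2 + eJ * R + (Real.sqrt dP + e0 + eJ) * S
        ≤ (2 * K1 + 3) * G2 := by
      have hx : (2 * K1 + 3) * G2 = (2 * K1 + 3) * (t ^ 4 * E) + (2 * K1 + 3) * (a ^ 2 * S ^ 2)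
          + (2 * K1 + 3) * (t ^ 2 * S * Q) := by rw [hG2def]; ring
      have h₆ : 0 ≤ (2 * K1 + 2) * (a ^ 2 * S ^ 2) := mul_nonneg (by linarith only [hK10]) haS2
      have h₇ : 0 ≤ (K1 + 2) * (t ^ 2 * S * Q) := mul_nonneg (by linarith only [hK10]) htSQ
      linarith only [hx, h₆, h₇, hdP, he0E, hEt, heJR, hcross1]
    calc dB + dBb ≤ _ := h2
      _ ≤ K2 * ((2 * K1 + 3) * G2) := mul_le_mul_of_nonneg_left hb hK20
      _ = c2 * G2 := by rw [hc2def]; ring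
  have hdB : dB ≤ c2 * G2 := by linarith only [hdBsum, hdBb0]
  have hdBb : dBb ≤ c2 * G2 := by linarith only [hdBsum, hdB0]
  -- Step 4: √G₂ ≤ Y := t²(Q+eJ) + aS + t u q, hence √dB, √dBb ≤ c2 Y
  set Y := t ^ 2 * (Q + eJ) + a * S + t * u * q with hYdef
  have htuq : 0 ≤ t * u * q := by positivity
  have haS : 0 ≤ a * S := mul_nonneg ha hS
  have htQ : 0 ≤ t ^ 2 * (Q + eJ) := mul_nonneg ht20 hQe0
  have hY0 : 0 ≤ Y := by rw [hYdef]; linarith only [htuq, haS, htQ]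
  have hG2Y : G2 ≤ Y ^ 2 := by
    have htuq2 : (t * u * q) ^ 2 = t ^ 2 * S * Q := by rw [mul_pow, mul_pow, hu2, hq2]
    have hx : Y ^ 2 = (t ^ 2 * (Q + eJ)) ^ 2 + (a * S) ^ 2 + (t * u * q) ^ 2
        + 2 * ((t ^ 2 * (Q + eJ)) * (a * S)) + 2 * ((t ^ 2 * (Q + eJ)) * (t * u * q))
        + 2 * ((a * S) * (t * u * q)) := by rw [hYdef]; ring
    have h₁ : t ^ 4 * E ≤ (t ^ 2 * (Q + eJ)) ^ 2 := by
      have h₀ := mul_le_mul_of_nonneg_left hEsq ht40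
      have hx' : (t ^ 2 * (Q + eJ)) ^ 2 = t ^ 4 * (Q + eJ) ^ 2 := by ring
      linarith only [h₀, hx']
    have h₂ : (a * S) ^ 2 = a ^ 2 * S ^ 2 := by ring
    have n1 := mul_nonneg htQ haS
    have n2 := mul_nonneg htQ htuq
    have n3 := mul_nonneg haS htuq
    rw [hG2def]; linarith only [htuq2, hx, h₁, h₂, n1, n2, n3]
  have hsqrt_c2 : ∀ d : ℝ, d ≤ c2 * G2 → Real.sqrt d ≤ c2 * Y := by
    intro d hd
    refine (Real.sqrt_le_sqrt ?_).trans (Real.sqrt_sq (mul_nonneg hc20 hY0)).le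
    have h₁ : c2 * G2 ≤ c2 * Y ^ 2 := mul_le_mul_of_nonneg_left hG2Y hc20
    have hc2sq : c2 ≤ c2 ^ 2 := by nlinarith only [hc21]
    have h₂ : c2 * Y ^ 2 ≤ c2 ^ 2 * Y ^ 2 := mul_le_mul_of_nonneg_right hc2sq (by positivity)
    calc d ≤ c2 * G2 := hd
      _ ≤ c2 * Y ^ 2 := h₁
      _ ≤ c2 ^ 2 * Y ^ 2 := h₂
      _ = (c2 * Y) ^ 2 := by ring
  have hsdB : Real.sqrt dB ≤ c2 * Y := hsqrt_c2 dB hdB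
  have hsdBb : Real.sqrt dBb ≤ c2 * Y := hsqrt_c2 dBb hdBb
  -- Step 5 (Prop 15.1.2): aA + aAb ≤ K3 (3 c2 + 6) G₁,  G₁ := t⁴E + a²S² + aS² + t²SQ + t S u q
  set G1 := t ^ 4 * E + a ^ 2 * S ^ 2 + a * S ^ 2 + t ^ 2 * S * Q + t * (S * u) * q with hG1def
  have htSuq : 0 ≤ t * (S * u) * q := by positivity
  have hG21 : G2 ≤ G1 := by rw [hG2def, hG1def]; linarith only [haS1, htSuq]
  have hG10 : 0 ≤ G1 := le_trans hG20 hG21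
  have hYS : Y * S ≤ t ^ 2 * S * Q + t ^ 4 * E + a * S ^ 2 + t * (S * u) * q := by
    have hx : Y * S = t ^ 2 * S * Q + t ^ 2 * (eJ * S) + a * S ^ 2 + t * (S * u) * q := by
      rw [hYdef]; ring
    linarith only [hx, ht2eJS]
  have haAsum : aA + aAb ≤ K3 * (3 * c2 + 6) * G1 := by
    have hb1 : (Real.sqrt dB + e0 + eJ) * S ≤ (c2 * Y + e0 + eJ) * S :=
      mul_le_mul_of_nonneg_right (by linarith only [hsdB]) hS
    have hb2 : (Real.sqrt dBb + e0 + eJ) * S ≤ (c2 * Y + e0 + eJ) * S :=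
      mul_le_mul_of_nonneg_right (by linarith only [hsdBb]) hS
    have hx : (c2 * Y + e0 + eJ) * S = c2 * (Y * S) + e0 * S + eJ * S := by ring
    have hcY : c2 * (Y * S) ≤ c2 * (t ^ 2 * S * Q + t ^ 4 * E + a * S ^ 2 + t * (S * u) * q) :=
      mul_le_mul_of_nonneg_left hYS hc20
    have h₅ : eJ * S ≤ t ^ 4 * E := le_trans heJS hEt
    have hG2c : c2 * G2 ≤ c2 * G1 := mul_le_mul_of_nonneg_left hG21 hc20
    have hb : dB + e0 ^ 2 + eJ ^ 2 + (Real.sqrt dB + e0 + eJ) * S + a ^ 2 * S ^ 2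
        + (dBb + e0 ^ 2 + eJ ^ 2 + (Real.sqrt dBb + e0 + eJ) * S + a ^ 2 * S ^ 2)
        ≤ (3 * c2 + 6) * G1 := by
      have hxG : (3 * c2 + 6) * G1 = (3 * c2 + 6) * (t ^ 4 * E) + (3 * c2 + 6) * (a ^ 2 * S ^ 2)
          + (3 * c2 + 6) * (a * S ^ 2) + (3 * c2 + 6) * (t ^ 2 * S * Q)
          + (3 * c2 + 6) * (t * (S * u) * q) := by
        rw [hG1def]; ring
      have hxG2 : c2 * G1 = c2 * (t ^ 4 * E) + c2 * (a ^ 2 * S ^ 2) + c2 * (a * S ^ 2)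
          + c2 * (t ^ 2 * S * Q) + c2 * (t * (S * u) * q) := by rw [hG1def]; ring
      have s1 : 0 ≤ (2 : ℝ) * (t ^ 4 * E) := by positivity
      have s2 : 0 ≤ (2 * c2 + 4) * (a ^ 2 * S ^ 2) := mul_nonneg (by linarith only [hc20]) haS2
      have s3 : 0 ≤ (6 : ℝ) * (a * S ^ 2) := by positivity
      have s4 : 0 ≤ (4 : ℝ) * (t ^ 2 * S * Q) := by positivity
      have s5 : 0 ≤ (6 : ℝ) * (t * (S * u) * q) := by positivity
      linarith only [hxG, hxG2, s1, s2, s3, s4, s5, hdBsum, hG2c, he0E, hEt, he0S, hb1, hb2, hx, hcY, h₅]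
    have h₆ := mul_le_mul_of_nonneg_left hb hK30
    have hx3 : K3 * ((3 * c2 + 6) * G1) = K3 * (3 * c2 + 6) * G1 := by ring
    linarith only [h₆, hx3, h3, h3b]
  -- Step 6: D ≤ cD G₁
  set cD := K1 + c2 + K3 * (3 * c2 + 6) with hcDdef
  have hcD0 : 0 ≤ cD := by rw [hcDdef]; positivity
  have hD : dP + dB + dBb + aA + aAb ≤ cD * G1 := by
    have h₁ : dP ≤ K1 * G1 := by
      have h₀ : t ^ 4 * E ≤ G1 := by rw [hG1def]; linarith only [haS2, haS1, htSQ, htSuq]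
      calc dP ≤ K1 * t ^ 4 * E := hdP
        _ = K1 * (t ^ 4 * E) := by ring
        _ ≤ K1 * G1 := mul_le_mul_of_nonneg_left h₀ hK10
    have h₂ : dB + dBb ≤ c2 * G1 := le_trans hdBsum (mul_le_mul_of_nonneg_left hG21 hc20)
    have hx : cD * G1 = K1 * G1 + c2 * G1 + K3 * (3 * c2 + 6) * G1 := by rw [hcDdef]; ring
    linarith only [h₁, h₂, hx, haAsum]
  -- Step 7: weighted AM–GM, G₁ ≤ 2A·(t⁴E + aS² + t S u q)
  have hAM : 3 * (t ^ 2 * S * Q) ≤ t ^ 4 * Q ^ 2 + 2 * (t * (S * u) * q) := by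
    have h₀ := amgm_tuq ht0 hu0 hq0
    rw [hu2, hq2] at h₀
    exact h₀
  have ha2 : a ^ 2 * S ^ 2 ≤ A * (a * S ^ 2) := by
    have h₀ := mul_le_mul_of_nonneg_right haA haS1
    have hx : a ^ 2 * S ^ 2 = a * (a * S ^ 2) := by ring
    linarith only [h₀, hx]
  have hGf : G1 ≤ 2 * A * (t ^ 4 * E + a * S ^ 2 + t * (S * u) * q) := by
    have h₁ : t ^ 4 * Q ^ 2 ≤ 2 * (t ^ 4 * E) := by
      have h₀ := mul_le_mul_of_nonneg_left hQ2E ht40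
      linarith only [h₀]
    have h₃ : 0 ≤ (2 * A - 5 / 3) * (t ^ 4 * E) := mul_nonneg (by linarith only [hA]) ht4E
    have h₄ : 0 ≤ (2 * A - 5 / 3) * (t * (S * u) * q) := mul_nonneg (by linarith only [hA]) htSuq
    have h₅ : 0 ≤ (A - 1) * (a * S ^ 2) := mul_nonneg (by linarith only [hA]) haS1
    rw [hG1def]; linarith only [hAM, h₁, ha2, h₃, h₄, h₅]
  -- Step 8: conclude
  have hK4r : 0 ≤ K4 * r0c := mul_nonneg hK4 hr0c
  have hfin : K4 * r0c * (dP + dB + dBb + aA + aAb)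
      ≤ K4 * r0c * (cD * (2 * A * (t ^ 4 * E + a * S ^ 2 + t * (S * u) * q))) :=
    mul_le_mul_of_nonneg_left (le_trans hD (mul_le_mul_of_nonneg_left hGf hcD0)) hK4r
  calc Rint2 ≤ K4 * r0c * (dP + dB + dBb + aA + aAb) := h4
    _ ≤ K4 * r0c * (cD * (2 * A * (t ^ 4 * E + a * S ^ 2 + t * (S * u) * q))) := hfin
    _ = 2 * A * K4 * cD * r0c * (t ^ 4 * E + a * S ^ 2 + t * (S * u) * q) := by ring

end Literature.Geometry.Lorentzian.GiorgiKlainermanSzeftel2022.CurvatureAssemblyArith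

end
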